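import Literature.Geometry.Lorentzian.KerrStarHorizonEnergyEstimate
import HarnessLib

/-!
# The flux of `J^{N,−1/2}` through the outer cylinder of `𝓐_N`, controlled by the transition slab
# (Aretakis 2012, §13.1: the region where `N` is cut off)

(family `gr`; namespace `Literature.Geometry.Lorentzian.Kerr.StarCoord`; written from the proving
seat of `Literature.Barriers.FinalStateConjecture.Aretakis2012_pointwiseDecay` — Aretakis, JFA 263
(2012), Thm. 5. The near-horizon `N`-energy estimate `nEnergy_box_estimate`
(`KerrStarHorizonEnergyEstimate.lean`) leaves explicit the flux of `J^{N,−1/2}` through the outer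
cylinder `{r = 23M/21}` of `𝓐_N`. In the source `N` is extended by a cut-off to the region
`{23M/21 ≤ r ≤ 8M/7}` where `J^N` has no sign, and the resulting spacetime error there is what the
integrated decay estimate (Thm. 1) controls. This file proves the corresponding statement in the
box formalism without a cut-off function: the outgoing flux through `{r = 23M/21}` is bounded by
slice and spacetime integrals over the transition slab of the positive density
`slabDensity = sin θ (M G² + M³((∂_{t*}G)² + (∂_rG)²) + M(∂_θG)²)` — by the energy identity on
`[t₁, t₂] × [23M/21, r']` for the radius `r'` of the slab minimising the outgoing flux, which is then
at most its average over `r' ∈ [23M/21, 8M/7]`, a slab integral.)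

* `slabDensity`, `slabDensity_nonneg`; closed forms `multFluxR_nCurrent`, `multDensity_nCurrent`;
* `abs_multDensity_nCurrent_le`, `abs_multFluxR_nCurrent_le` (`≤ 120 · slabDensity`),
  `mul_abs_multBulk_nCurrent_le` (`M·|bulk| ≤ 100 · slabDensity`) on `M ≤ r ≤ 2M` (real-variable
  cores `*_bracket_abs_le`), and `slabDensity_deriv_le_tEnergy` (the derivative part of the slab
  density is `≤ 221 M e_T` for `r ≥ 23M/21`);
* plumbing: `continuous_box_integrals_clamped`, `t_theta_integral_mono_of_line`,
  `continuous_flux_clamped`, `flux2_integral_mono` (and a private Fubini `swap2`);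
* `outerFlux_nCurrent_le` (**the bound**): for `G` smooth on an open
  `W₀ ⊇ [t₁, t₂] × [23M/21, 8M/7] × [0, π]` with `𝓡G + 𝓐G = 0` off the axis,
  `∫_{t₁}^{t₂}∫₀^π F_N(t, 23M/21, θ) ≤ 120 (S(t₁) + S(t₂)) + (2620/M) ∫_{t₁}^{t₂} S(t) dt`,
  `S(t) = ∫₀^π∫_{23M/21}^{8M/7} slabDensity(p(t, r, θ))`.

Everything is proved; no named facts.

## References

* S. Aretakis, *Decay of axisymmetric solutions of the wave equation on extreme Kerr backgrounds*,
  J. Funct. Anal. 263 (2012) 2770–2831 (arXiv:1110.2006): §13.1 (the cut-off `N^δ` and the use of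
  Thm. 1 in the transition region), §7.2 (key `Aretakis2012`).
-/

noncomputable section

open Real Set Filter
open scoped Topology ContDiff

namespace Literature.Geometry.Lorentzian

namespace Kerr

namespace StarCoord

variable {M : ℝ}

/-! ### Pointwise bounds on the transition slab -/


/-- The positive-definite comparison density on the transition slab:
`sin θ (M G² + M³((∂_{t*}G)² + (∂_rG)²) + M (∂_θG)²)`. [cite: Aretakis2012, §13.1] -/
def slabDensity (M : ℝ) (G : E4 → ℝ) : E4 → ℝ := fun q ↦
  sin (q 2) * (M * G q ^ 2 + M ^ 3 * (pd 0 G q ^ 2 + pd 1 G q ^ 2) + M * pd 2 G q ^ 2)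

/-- The slab density is non-negative for `θ ∈ [0, π]`, `M ≥ 0`. [folklore] -/
theorem slabDensity_nonneg (hM : 0 ≤ M) (G : E4 → ℝ) {q : E4} (hθ : q 2 ∈ Icc 0 π) :
    0 ≤ slabDensity M G q := by
  unfold slabDensity
  have hs : 0 ≤ sin (q 2) := sin_nonneg_of_nonneg_of_le_pi hθ.1 hθ.2
  positivity

/-- Closed form of the radial flux of `J^{N,−1/2}`. [cite: Aretakis2012, §7.2] -/
theorem multFluxR_nCurrent (M : ℝ) (G : E4 → ℝ) (q : E4) :
    multFluxR M M (nProfileR M) (nProfileT M) nProfileW G q =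
      sin (q 2) * (1 / 2 * (-2 * q 1 + M) * ((q 1 ^ 2 - 2 * M * q 1 + M ^ 2) * pd 1 G q ^ 2 +
          (q 1 ^ 2 + M ^ 2 * cos (q 2) ^ 2 + 2 * M * q 1) * pd 0 G q ^ 2 - pd 2 G q ^ 2) +
        (20 * q 1 - 37 / 2 * M) * ((q 1 ^ 2 - 2 * M * q 1 + M ^ 2) * pd 1 G q * pd 0 G q +
          2 * M * q 1 * pd 0 G q ^ 2) -
        1 / 2 * (q 1 ^ 2 - 2 * M * q 1 + M ^ 2) * G q * pd 1 G q) := by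
  simp only [multFluxR, radMultFluxR, timeMultFluxR, tFluxR, lagFluxR, nProfileR, nProfileT, nProfileW,
    deriv_nProfileW]
  ring

/-- Closed form of the energy density of `J^{N,−1/2}` (cf. `neg_multDensity_nCurrent`).
[cite: Aretakis2012, §7.2] -/
theorem multDensity_nCurrent (M : ℝ) (G : E4 → ℝ) (q : E4) :
    multDensity M M (nProfileR M) (nProfileT M) nProfileW G q =
      sin (q 2) * ((-2 * q 1 + M) * (2 * M * q 1 * pd 1 G q ^ 2 -
          (q 1 ^ 2 + M ^ 2 * cos (q 2) ^ 2 + 2 * M * q 1) * pd 1 G q * pd 0 G q) -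
        (20 * q 1 - 37 / 2 * M) * (1 / 2 * ((q 1 ^ 2 - 2 * M * q 1 + M ^ 2) * pd 1 G q ^ 2 +
          (q 1 ^ 2 + M ^ 2 * cos (q 2) ^ 2 + 2 * M * q 1) * pd 0 G q ^ 2 + pd 2 G q ^ 2)) -
        1 / 2 * (4 * M * q 1 * G q * pd 1 G q + M * G q ^ 2 -
          (q 1 ^ 2 + M ^ 2 * cos (q 2) ^ 2 + 2 * M * q 1) * G q * pd 0 G q)) := by
  simp only [multDensity, radMultDensity, timeMultDensity, tEnergy, lagDensity, nProfileR, nProfileT,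
    nProfileW]
  ring
set_option maxHeartbeats 400000 in -- buildfix (bf3-g26): 160k/180k FAIL, 200k PASS at accept time; line-neutral budget line
/-- The real-variable core of `abs_multDensity_nCurrent_le`. [folklore] -/
theorem multDensity_bracket_abs_le (hM : 0 < M) {r c2 : ℝ} (hr₁ : M ≤ r) (hr₂ : r ≤ 2 * M)
    (hc : c2 ≤ 1) (hc0 : 0 ≤ c2) (g g₀ g₁ g₂ : ℝ) :
    |(-2 * r + M) * (2 * M * r * g₁ ^ 2 - (r ^ 2 + M ^ 2 * c2 + 2 * M * r) * g₁ * g₀) -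
        (20 * r - 37 / 2 * M) * (1 / 2 * ((r ^ 2 - 2 * M * r + M ^ 2) * g₁ ^ 2 +
          (r ^ 2 + M ^ 2 * c2 + 2 * M * r) * g₀ ^ 2 + g₂ ^ 2)) -
        1 / 2 * (4 * M * r * g * g₁ + M * g ^ 2 - (r ^ 2 + M ^ 2 * c2 + 2 * M * r) * g * g₀)| ≤
      120 * (M * g ^ 2 + M ^ 3 * (g₀ ^ 2 + g₁ ^ 2) + M * g₂ ^ 2) := by
  have hr0 : 0 ≤ r := by linarith
  have hf : |(-2 * r + M)| ≤ 3 * M := by rw [abs_le]; constructor <;> linarith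
  have hh : |20 * r - 37 / 2 * M| ≤ 22 * M := by rw [abs_le]; constructor <;> linarith
  have hΔ : 0 ≤ r ^ 2 - 2 * M * r + M ^ 2 := by nlinarith [sq_nonneg (r - M)]
  have hΔ' : r ^ 2 - 2 * M * r + M ^ 2 ≤ M ^ 2 := by nlinarith
  have hS : 0 ≤ r ^ 2 + M ^ 2 * c2 + 2 * M * r := by positivity
  have hS' : r ^ 2 + M ^ 2 * c2 + 2 * M * r ≤ 9 * M ^ 2 := by nlinarith
  have hgg₁ : 2 * M * (|g| * |g₁|) ≤ g ^ 2 + M ^ 2 * g₁ ^ 2 := by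
    nlinarith [sq_nonneg (|g| - M * |g₁|), sq_abs g, sq_abs g₁]
  have hgg₀ : 2 * M * (|g| * |g₀|) ≤ g ^ 2 + M ^ 2 * g₀ ^ 2 := by
    nlinarith [sq_nonneg (|g| - M * |g₀|), sq_abs g, sq_abs g₀]
  have hg₁g₀ : |g₁| * |g₀| ≤ (g₁ ^ 2 + g₀ ^ 2) / 2 := by
    nlinarith [sq_nonneg (|g₁| - |g₀|), sq_abs g₁, sq_abs g₀]
  have hX₁ : 0 ≤ |g| * |g₁| := mul_nonneg (abs_nonneg _) (abs_nonneg _)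
  have hX₀ : 0 ≤ |g| * |g₀| := mul_nonneg (abs_nonneg _) (abs_nonneg _)
  have hY : 0 ≤ |g₁| * |g₀| := mul_nonneg (abs_nonneg _) (abs_nonneg _)
  -- the three pieces
  have p1 : |(-2 * r + M) * (2 * M * r * g₁ ^ 2 - (r ^ 2 + M ^ 2 * c2 + 2 * M * r) * g₁ * g₀)| ≤
      3 * M * (4 * M ^ 2 * g₁ ^ 2 + 9 * M ^ 2 * ((g₁ ^ 2 + g₀ ^ 2) / 2)) := by
    rw [abs_mul]
    refine mul_le_mul hf ?_ (abs_nonneg _) (by positivity)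
    refine (abs_sub _ _).trans ?_
    have a1 : |2 * M * r * g₁ ^ 2| ≤ 4 * M ^ 2 * g₁ ^ 2 := by
      rw [abs_of_nonneg (by positivity)]
      nlinarith [mul_le_mul_of_nonneg_right hr₂ (mul_nonneg (by positivity : (0:ℝ) ≤ 2 * M) (sq_nonneg g₁))]
    have a2 : |(r ^ 2 + M ^ 2 * c2 + 2 * M * r) * g₁ * g₀| ≤ 9 * M ^ 2 * ((g₁ ^ 2 + g₀ ^ 2) / 2) := by
      rw [abs_mul, abs_mul, abs_of_nonneg hS, mul_assoc]
      exact mul_le_mul hS' hg₁g₀ hY (by positivity)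
    linarith
  have p2 : |(20 * r - 37 / 2 * M) * (1 / 2 * ((r ^ 2 - 2 * M * r + M ^ 2) * g₁ ^ 2 +
      (r ^ 2 + M ^ 2 * c2 + 2 * M * r) * g₀ ^ 2 + g₂ ^ 2))| ≤
      22 * M * (1 / 2 * (M ^ 2 * g₁ ^ 2 + 9 * M ^ 2 * g₀ ^ 2 + g₂ ^ 2)) := by
    rw [abs_mul]
    refine mul_le_mul hh ?_ (abs_nonneg _) (by positivity)
    rw [abs_of_nonneg (by positivity)]
    nlinarith [mul_le_mul_of_nonneg_right hΔ' (sq_nonneg g₁), mul_le_mul_of_nonneg_right hS' (sq_nonneg g₀)]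
  have p3 : |1 / 2 * (4 * M * r * g * g₁ + M * g ^ 2 - (r ^ 2 + M ^ 2 * c2 + 2 * M * r) * g * g₀)| ≤
      1 / 2 * (4 * (M * g ^ 2 + M ^ 3 * g₁ ^ 2) + M * g ^ 2 + 9 / 2 * (M * g ^ 2 + M ^ 3 * g₀ ^ 2)) := by
    rw [abs_mul, abs_of_nonneg (by norm_num : (0 : ℝ) ≤ 1 / 2)]
    refine mul_le_mul_of_nonneg_left ?_ (by norm_num)
    refine (abs_sub _ _).trans ?_
    refine (add_le_add (abs_add_le _ _) le_rfl).trans ?_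
    have b1 : |4 * M * r * g * g₁| ≤ 4 * (M * g ^ 2 + M ^ 3 * g₁ ^ 2) := by
      rw [show 4 * M * r * g * g₁ = (4 * M * r) * (g * g₁) by ring, abs_mul, abs_of_nonneg (by positivity),
        abs_mul]
      have h1 := mul_le_mul_of_nonneg_right hr₂ (mul_nonneg (by positivity : (0 : ℝ) ≤ 4 * M) hX₁)
      have h2 := mul_le_mul_of_nonneg_left hgg₁ (by positivity : (0 : ℝ) ≤ 4 * M)
      nlinarith
    have b2 : |M * g ^ 2| ≤ M * g ^ 2 := by rw [abs_of_nonneg (by positivity)]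
    have b3 : |(r ^ 2 + M ^ 2 * c2 + 2 * M * r) * g * g₀| ≤ 9 / 2 * (M * g ^ 2 + M ^ 3 * g₀ ^ 2) := by
      rw [abs_mul, abs_mul, abs_of_nonneg hS, mul_assoc]
      have h9 := mul_le_mul_of_nonneg_right hS' hX₀
      have h2 := mul_le_mul_of_nonneg_left hgg₀ (by positivity : (0 : ℝ) ≤ 9 / 2 * M)
      nlinarith
    linarith
  refine (abs_sub _ _).trans ?_
  refine (add_le_add (abs_sub _ _) le_rfl).trans ?_
  have hg : 0 ≤ g ^ 2 := sq_nonneg _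
  have hg0 : 0 ≤ g₀ ^ 2 := sq_nonneg _
  have hg1 : 0 ≤ g₁ ^ 2 := sq_nonneg _
  have hg2 : 0 ≤ g₂ ^ 2 := sq_nonneg _
  nlinarith [p1, p2, p3, mul_nonneg hM.le hg, mul_nonneg (pow_nonneg hM.le 3) hg0,
    mul_nonneg (pow_nonneg hM.le 3) hg1, mul_nonneg hM.le hg2]

/-- **Slab bound for the energy density of `J^{N,−1/2}`**: on `M ≤ r ≤ 2M`, `θ ∈ [0, π]`,
`|E-density| ≤ 120 · slabDensity`. [cite: Aretakis2012, §13.1] -/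
theorem abs_multDensity_nCurrent_le (hM : 0 < M) (G : E4 → ℝ) {q : E4} (hr₁ : M ≤ q 1)
    (hr₂ : q 1 ≤ 2 * M) (hθ : q 2 ∈ Icc 0 π) :
    |multDensity M M (nProfileR M) (nProfileT M) nProfileW G q| ≤ 120 * slabDensity M G q := by
  have hs : 0 ≤ sin (q 2) := sin_nonneg_of_nonneg_of_le_pi hθ.1 hθ.2
  have hc : cos (q 2) ^ 2 ≤ 1 := by rw [sq_le_one_iff_abs_le_one]; exact abs_cos_le_one _
  have hb := multDensity_bracket_abs_le hM hr₁ hr₂ hc (sq_nonneg _) (G q) (pd 0 G q) (pd 1 G q) (pd 2 G q)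
  rw [multDensity_nCurrent, abs_mul, abs_of_nonneg hs]
  unfold slabDensity
  rw [show 120 * (sin (q 2) * (M * G q ^ 2 + M ^ 3 * (pd 0 G q ^ 2 + pd 1 G q ^ 2) + M * pd 2 G q ^ 2)) =
    sin (q 2) * (120 * (M * G q ^ 2 + M ^ 3 * (pd 0 G q ^ 2 + pd 1 G q ^ 2) + M * pd 2 G q ^ 2)) by ring]
  exact mul_le_mul_of_nonneg_left hb hs

/-- The real-variable core of `abs_multFluxR_nCurrent_le`. [folklore] -/
theorem multFluxR_bracket_abs_le (hM : 0 < M) {r c2 : ℝ} (hr₁ : M ≤ r) (hr₂ : r ≤ 2 * M)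
    (hc : c2 ≤ 1) (hc0 : 0 ≤ c2) (g g₀ g₁ g₂ : ℝ) :
    |1 / 2 * (-2 * r + M) * ((r ^ 2 - 2 * M * r + M ^ 2) * g₁ ^ 2 +
          (r ^ 2 + M ^ 2 * c2 + 2 * M * r) * g₀ ^ 2 - g₂ ^ 2) +
        (20 * r - 37 / 2 * M) * ((r ^ 2 - 2 * M * r + M ^ 2) * g₁ * g₀ + 2 * M * r * g₀ ^ 2) -
        1 / 2 * (r ^ 2 - 2 * M * r + M ^ 2) * g * g₁| ≤
      120 * (M * g ^ 2 + M ^ 3 * (g₀ ^ 2 + g₁ ^ 2) + M * g₂ ^ 2) := by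
  have hr0 : 0 ≤ r := by linarith
  have hf : |1 / 2 * (-2 * r + M)| ≤ 3 / 2 * M := by rw [abs_le]; constructor <;> linarith
  have hh : |20 * r - 37 / 2 * M| ≤ 22 * M := by rw [abs_le]; constructor <;> linarith
  have hΔ : 0 ≤ r ^ 2 - 2 * M * r + M ^ 2 := by nlinarith [sq_nonneg (r - M)]
  have hΔ' : r ^ 2 - 2 * M * r + M ^ 2 ≤ M ^ 2 := by nlinarith
  have hS : 0 ≤ r ^ 2 + M ^ 2 * c2 + 2 * M * r := by positivity
  have hS' : r ^ 2 + M ^ 2 * c2 + 2 * M * r ≤ 9 * M ^ 2 := by nlinarith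
  have hgg₁ : 2 * M * (|g| * |g₁|) ≤ g ^ 2 + M ^ 2 * g₁ ^ 2 := by
    nlinarith [sq_nonneg (|g| - M * |g₁|), sq_abs g, sq_abs g₁]
  have hg₁g₀ : |g₁| * |g₀| ≤ (g₁ ^ 2 + g₀ ^ 2) / 2 := by
    nlinarith [sq_nonneg (|g₁| - |g₀|), sq_abs g₁, sq_abs g₀]
  have hX₁ : 0 ≤ |g| * |g₁| := mul_nonneg (abs_nonneg _) (abs_nonneg _)
  have hY : 0 ≤ |g₁| * |g₀| := mul_nonneg (abs_nonneg _) (abs_nonneg _)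
  have p1 : |1 / 2 * (-2 * r + M) * ((r ^ 2 - 2 * M * r + M ^ 2) * g₁ ^ 2 +
      (r ^ 2 + M ^ 2 * c2 + 2 * M * r) * g₀ ^ 2 - g₂ ^ 2)| ≤
      3 / 2 * M * (M ^ 2 * g₁ ^ 2 + 9 * M ^ 2 * g₀ ^ 2 + g₂ ^ 2) := by
    rw [abs_mul]
    refine mul_le_mul hf ?_ (abs_nonneg _) (by positivity)
    refine (abs_sub _ _).trans ?_
    rw [abs_of_nonneg (by positivity : (0 : ℝ) ≤ (r ^ 2 - 2 * M * r + M ^ 2) * g₁ ^ 2 +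
      (r ^ 2 + M ^ 2 * c2 + 2 * M * r) * g₀ ^ 2), abs_of_nonneg (sq_nonneg g₂)]
    nlinarith [mul_le_mul_of_nonneg_right hΔ' (sq_nonneg g₁), mul_le_mul_of_nonneg_right hS' (sq_nonneg g₀)]
  have p2 : |(20 * r - 37 / 2 * M) * ((r ^ 2 - 2 * M * r + M ^ 2) * g₁ * g₀ + 2 * M * r * g₀ ^ 2)| ≤
      22 * M * (M ^ 2 * ((g₁ ^ 2 + g₀ ^ 2) / 2) + 4 * M ^ 2 * g₀ ^ 2) := by
    rw [abs_mul]
    refine mul_le_mul hh ?_ (abs_nonneg _) (by positivity)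
    refine (abs_add_le _ _).trans ?_
    have a1 : |(r ^ 2 - 2 * M * r + M ^ 2) * g₁ * g₀| ≤ M ^ 2 * ((g₁ ^ 2 + g₀ ^ 2) / 2) := by
      rw [abs_mul, abs_mul, abs_of_nonneg hΔ, mul_assoc]
      exact mul_le_mul hΔ' hg₁g₀ hY (by positivity)
    have a2 : |2 * M * r * g₀ ^ 2| ≤ 4 * M ^ 2 * g₀ ^ 2 := by
      rw [abs_of_nonneg (by positivity)]
      nlinarith [mul_le_mul_of_nonneg_right hr₂ (mul_nonneg (by positivity : (0:ℝ) ≤ 2 * M) (sq_nonneg g₀))]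
    linarith
  have p3 : |1 / 2 * (r ^ 2 - 2 * M * r + M ^ 2) * g * g₁| ≤ 1 / 4 * (M * g ^ 2 + M ^ 3 * g₁ ^ 2) := by
    rw [abs_mul, abs_mul, abs_mul, abs_of_nonneg (by norm_num : (0 : ℝ) ≤ 1 / 2), abs_of_nonneg hΔ]
    have h1 : 1 / 2 * (r ^ 2 - 2 * M * r + M ^ 2) * |g| * |g₁| ≤ 1 / 2 * M ^ 2 * (|g| * |g₁|) := by
      rw [mul_assoc (1 / 2 * (r ^ 2 - 2 * M * r + M ^ 2))]
      exact mul_le_mul_of_nonneg_right (by linarith) hX₁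
    have h2 := mul_le_mul_of_nonneg_left hgg₁ (by positivity : (0 : ℝ) ≤ 1 / 4 * M)
    nlinarith
  refine (abs_sub _ _).trans ?_
  refine (add_le_add (abs_add_le _ _) le_rfl).trans ?_
  have hg : 0 ≤ g ^ 2 := sq_nonneg _
  have hg0 : 0 ≤ g₀ ^ 2 := sq_nonneg _
  have hg1 : 0 ≤ g₁ ^ 2 := sq_nonneg _
  have hg2 : 0 ≤ g₂ ^ 2 := sq_nonneg _
  nlinarith [p1, p2, p3, mul_nonneg hM.le hg, mul_nonneg (pow_nonneg hM.le 3) hg0,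
    mul_nonneg (pow_nonneg hM.le 3) hg1, mul_nonneg hM.le hg2]

/-- **Slab bound for the radial flux of `J^{N,−1/2}`**: on `M ≤ r ≤ 2M`, `θ ∈ [0, π]`,
`|F_N| ≤ 120 · slabDensity`. [cite: Aretakis2012, §13.1] -/
theorem abs_multFluxR_nCurrent_le (hM : 0 < M) (G : E4 → ℝ) {q : E4} (hr₁ : M ≤ q 1)
    (hr₂ : q 1 ≤ 2 * M) (hθ : q 2 ∈ Icc 0 π) :
    |multFluxR M M (nProfileR M) (nProfileT M) nProfileW G q| ≤ 120 * slabDensity M G q := by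
  have hs : 0 ≤ sin (q 2) := sin_nonneg_of_nonneg_of_le_pi hθ.1 hθ.2
  have hc : cos (q 2) ^ 2 ≤ 1 := by rw [sq_le_one_iff_abs_le_one]; exact abs_cos_le_one _
  have hb := multFluxR_bracket_abs_le hM hr₁ hr₂ hc (sq_nonneg _) (G q) (pd 0 G q) (pd 1 G q) (pd 2 G q)
  rw [multFluxR_nCurrent, abs_mul, abs_of_nonneg hs]
  unfold slabDensity
  rw [show 120 * (sin (q 2) * (M * G q ^ 2 + M ^ 3 * (pd 0 G q ^ 2 + pd 1 G q ^ 2) + M * pd 2 G q ^ 2)) =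
    sin (q 2) * (120 * (M * G q ^ 2 + M ^ 3 * (pd 0 G q ^ 2 + pd 1 G q ^ 2) + M * pd 2 G q ^ 2)) by ring]
  exact mul_le_mul_of_nonneg_left hb hs

/-- The real-variable core of `mul_abs_multBulk_nCurrent_le`. [folklore] -/
theorem multBulk_bracket_abs_le (hM : 0 < M) {r c2 : ℝ} (hr₁ : M ≤ r) (hr₂ : r ≤ 2 * M)
    (hc : c2 ≤ 1) (hc0 : 0 ≤ c2) (g g₀ g₁ g₂ : ℝ) :
    M * |-(1 / 2 * (r - M) * (r + M)) * g₁ ^ 2 - 2 * (r - M) * (10 * r - 9 * M) * g₀ * g₁ +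
        (5 / 2 * r ^ 2 - 38 * M * r - M ^ 2 + 1 / 2 * M ^ 2 * c2) * g₀ ^ 2 - 1 / 2 * g₂ ^ 2| ≤
      100 * (M * g ^ 2 + M ^ 3 * (g₀ ^ 2 + g₁ ^ 2) + M * g₂ ^ 2) := by
  have hr0 : 0 ≤ r := by linarith
  have h1 : |(-(1 / 2 * (r - M) * (r + M)))| ≤ 3 / 2 * M ^ 2 := by
    rw [abs_le]; constructor <;> nlinarith
  have h2 : |2 * (r - M) * (10 * r - 9 * M)| ≤ 22 * M ^ 2 := by
    rw [abs_le]; constructor <;> nlinarith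
  have h3 : |5 / 2 * r ^ 2 - 38 * M * r - M ^ 2 + 1 / 2 * M ^ 2 * c2| ≤ 88 * M ^ 2 := by
    rw [abs_le]; constructor <;> nlinarith
  have hg₀g₁ : |g₀| * |g₁| ≤ (g₀ ^ 2 + g₁ ^ 2) / 2 := by
    nlinarith [sq_nonneg (|g₀| - |g₁|), sq_abs g₀, sq_abs g₁]
  have hY : 0 ≤ |g₀| * |g₁| := mul_nonneg (abs_nonneg _) (abs_nonneg _)
  have p1 : |-(1 / 2 * (r - M) * (r + M)) * g₁ ^ 2| ≤ 3 / 2 * M ^ 2 * g₁ ^ 2 := by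
    rw [abs_mul, abs_of_nonneg (sq_nonneg g₁)]
    exact mul_le_mul_of_nonneg_right h1 (sq_nonneg _)
  have p2 : |2 * (r - M) * (10 * r - 9 * M) * g₀ * g₁| ≤ 22 * M ^ 2 * ((g₀ ^ 2 + g₁ ^ 2) / 2) := by
    rw [abs_mul, abs_mul, mul_assoc]
    exact mul_le_mul h2 hg₀g₁ hY (by positivity)
  have p3 : |(5 / 2 * r ^ 2 - 38 * M * r - M ^ 2 + 1 / 2 * M ^ 2 * c2) * g₀ ^ 2| ≤ 88 * M ^ 2 * g₀ ^ 2 := by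
    rw [abs_mul, abs_of_nonneg (sq_nonneg g₀)]
    exact mul_le_mul_of_nonneg_right h3 (sq_nonneg _)
  have p4 : |1 / 2 * g₂ ^ 2| = 1 / 2 * g₂ ^ 2 := abs_of_nonneg (by positivity)
  have habs : |-(1 / 2 * (r - M) * (r + M)) * g₁ ^ 2 - 2 * (r - M) * (10 * r - 9 * M) * g₀ * g₁ +
      (5 / 2 * r ^ 2 - 38 * M * r - M ^ 2 + 1 / 2 * M ^ 2 * c2) * g₀ ^ 2 - 1 / 2 * g₂ ^ 2| ≤
      3 / 2 * M ^ 2 * g₁ ^ 2 + 22 * M ^ 2 * ((g₀ ^ 2 + g₁ ^ 2) / 2) + 88 * M ^ 2 * g₀ ^ 2 + 1 / 2 * g₂ ^ 2 := by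
    refine (abs_sub _ _).trans ?_
    refine (add_le_add (abs_add_le _ _) le_rfl).trans ?_
    refine (add_le_add (add_le_add (abs_sub _ _) le_rfl) le_rfl).trans ?_
    linarith
  have hg : 0 ≤ g ^ 2 := sq_nonneg _
  have hg0 : 0 ≤ g₀ ^ 2 := sq_nonneg _
  have hg1 : 0 ≤ g₁ ^ 2 := sq_nonneg _
  have hg2 : 0 ≤ g₂ ^ 2 := sq_nonneg _
  have hM1 : M * (1 / 2 * g₂ ^ 2) ≤ 100 * (M * g₂ ^ 2) := by nlinarith
  nlinarith [mul_le_mul_of_nonneg_left habs hM.le, mul_nonneg hM.le hg, mul_nonneg (pow_nonneg hM.le 3) hg0,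
    mul_nonneg (pow_nonneg hM.le 3) hg1, mul_nonneg hM.le hg2]

/-- **Slab bound for the bulk of `J^{N,−1/2}`**: on `M ≤ r ≤ 2M`, `θ ∈ [0, π]`,
`M · |bulk| ≤ 100 · slabDensity`. [cite: Aretakis2012, §13.1] -/
theorem mul_abs_multBulk_nCurrent_le (hM : 0 < M) (G : E4 → ℝ) {q : E4} (hr₁ : M ≤ q 1)
    (hr₂ : q 1 ≤ 2 * M) (hθ : q 2 ∈ Icc 0 π) :
    M * |multBulk M M (nProfileR M) (nProfileT M) nProfileW G q| ≤ 100 * slabDensity M G q := by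
  have hs : 0 ≤ sin (q 2) := sin_nonneg_of_nonneg_of_le_pi hθ.1 hθ.2
  have hc : cos (q 2) ^ 2 ≤ 1 := by rw [sq_le_one_iff_abs_le_one]; exact abs_cos_le_one _
  have hb := multBulk_bracket_abs_le hM hr₁ hr₂ hc (sq_nonneg _) (G q) (pd 0 G q) (pd 1 G q) (pd 2 G q)
  rw [multBulk_nCurrent, abs_mul, abs_of_nonneg hs]
  unfold slabDensity
  rw [show 100 * (sin (q 2) * (M * G q ^ 2 + M ^ 3 * (pd 0 G q ^ 2 + pd 1 G q ^ 2) + M * pd 2 G q ^ 2)) =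
    sin (q 2) * (100 * (M * G q ^ 2 + M ^ 3 * (pd 0 G q ^ 2 + pd 1 G q ^ 2) + M * pd 2 G q ^ 2)) by ring,
    show M * (sin (q 2) * |-(1 / 2 * (q 1 - M) * (q 1 + M)) * pd 1 G q ^ 2 -
      2 * (q 1 - M) * (10 * q 1 - 9 * M) * pd 0 G q * pd 1 G q +
      (5 / 2 * q 1 ^ 2 - 38 * M * q 1 - M ^ 2 + 1 / 2 * M ^ 2 * cos (q 2) ^ 2) * pd 0 G q ^ 2 -
      1 / 2 * pd 2 G q ^ 2|) = sin (q 2) * (M * |-(1 / 2 * (q 1 - M) * (q 1 + M)) * pd 1 G q ^ 2 -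
      2 * (q 1 - M) * (10 * q 1 - 9 * M) * pd 0 G q * pd 1 G q +
      (5 / 2 * q 1 ^ 2 - 38 * M * q 1 - M ^ 2 + 1 / 2 * M ^ 2 * cos (q 2) ^ 2) * pd 0 G q ^ 2 -
      1 / 2 * pd 2 G q ^ 2|) by ring]
  exact mul_le_mul_of_nonneg_left hb hs

/-- **The slab density is dominated by the `T`-energy density in its derivative part**: on the
slab `23M/21 ≤ r ≤ 2M`, `θ ∈ [0, π]`: `sin θ (M³((∂_{t*}G)² + (∂_rG)²) + M(∂_θG)²) ≤ 221 M · e_T`.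
[cite: Aretakis2012, §13.1] -/
theorem slabDensity_deriv_le_tEnergy (hM : 0 < M) (G : E4 → ℝ) {q : E4} (hr₁ : 23 / 21 * M ≤ q 1)
    (hθ : q 2 ∈ Icc 0 π) :
    sin (q 2) * (M ^ 3 * (pd 0 G q ^ 2 + pd 1 G q ^ 2) + M * pd 2 G q ^ 2) ≤ 221 * M * tEnergy M M G q := by
  have hs : 0 ≤ sin (q 2) := sin_nonneg_of_nonneg_of_le_pi hθ.1 hθ.2
  have hc0 : 0 ≤ cos (q 2) ^ 2 := sq_nonneg _
  simp only [tEnergy]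
  have hΔ : 4 / 441 * M ^ 2 ≤ q 1 ^ 2 - 2 * M * q 1 + M ^ 2 := by nlinarith
  have hSg : M ^ 2 ≤ q 1 ^ 2 + M ^ 2 * cos (q 2) ^ 2 + 2 * M * q 1 := by nlinarith
  have hΔ0 : 0 ≤ q 1 ^ 2 - 2 * M * q 1 + M ^ 2 := by nlinarith
  have hS0 : 0 ≤ q 1 ^ 2 + M ^ 2 * cos (q 2) ^ 2 + 2 * M * q 1 := by nlinarith
  have t1 : M * (4 / 441 * M ^ 2 * pd 1 G q ^ 2) ≤ M * ((q 1 ^ 2 - 2 * M * q 1 + M ^ 2) * pd 1 G q ^ 2) :=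
    mul_le_mul_of_nonneg_left (mul_le_mul_of_nonneg_right hΔ (sq_nonneg _)) hM.le
  have t0 : M * (M ^ 2 * pd 0 G q ^ 2) ≤ M * ((q 1 ^ 2 + M ^ 2 * cos (q 2) ^ 2 + 2 * M * q 1) * pd 0 G q ^ 2) :=
    mul_le_mul_of_nonneg_left (mul_le_mul_of_nonneg_right hSg (sq_nonneg _)) hM.le
  have n1 : 0 ≤ M * ((q 1 ^ 2 - 2 * M * q 1 + M ^ 2) * pd 1 G q ^ 2) := by positivity
  have n0 : 0 ≤ M * ((q 1 ^ 2 + M ^ 2 * cos (q 2) ^ 2 + 2 * M * q 1) * pd 0 G q ^ 2) := by positivity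
  have n2 : 0 ≤ M * pd 2 G q ^ 2 := by positivity
  have key : M ^ 3 * (pd 0 G q ^ 2 + pd 1 G q ^ 2) + M * pd 2 G q ^ 2 ≤
      221 * M * (1 / 2 * ((q 1 ^ 2 - 2 * M * q 1 + M ^ 2) * pd 1 G q ^ 2 +
        (q 1 ^ 2 + M ^ 2 * cos (q 2) ^ 2 + 2 * M * q 1) * pd 0 G q ^ 2 + pd 2 G q ^ 2)) := by
    linarith
  have := mul_le_mul_of_nonneg_left key hs
  linarith


/-! ### Iterated-integral plumbing -/

section Plumbing

variable {W₀ : Set E4}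

/-- Clamping is the identity on the interval. [folklore] -/
private theorem clampI_eq {a b x : ℝ} (hx : x ∈ Icc a b) : max a (min x b) = x := by
  rw [min_eq_left hx.2, max_eq_right hx.1]

/-- Fubini for a continuous function on a rectangle. [folklore] -/
private theorem swap2 {f : ℝ → ℝ → ℝ} (hf : Continuous (Function.uncurry f))
    {a b c d : ℝ} (hab : a ≤ b) (hcd : c ≤ d) :
    ∫ x in a..b, ∫ y in c..d, f x y = ∫ y in c..d, ∫ x in a..b, f x y := by
  simp only [intervalIntegral.integral_of_le hab, intervalIntegral.integral_of_le hcd]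
  have hint : MeasureTheory.Integrable (Function.uncurry f)
      (((MeasureTheory.volume : MeasureTheory.Measure ℝ).restrict (Ioc a b)).prod
        ((MeasureTheory.volume : MeasureTheory.Measure ℝ).restrict (Ioc c d))) := by
    rw [MeasureTheory.Measure.prod_restrict, ← MeasureTheory.Measure.volume_eq_prod]
    exact (hf.continuousOn.integrableOn_compact (isCompact_Icc.prod isCompact_Icc)).mono_set
      (Set.prod_mono Ioc_subset_Icc_self Ioc_subset_Icc_self)
  exact MeasureTheory.integral_integral_swap hint

/-- Continuity of the clamped `(θ, r)`-box integral in `t` and of the clamped `r`-line integral in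
`(t, θ)` (cf. the proof of `box3_integral_mono`). [folklore] -/
theorem continuous_box_integrals_clamped {H : E4 → ℝ} (hH : ContinuousOn H W₀)
    {t₁ t₂ r₁ r₂ φ₀ : ℝ} (ht : t₁ ≤ t₂) (hr : r₁ ≤ r₂)
    (hbox : ∀ t ∈ Icc t₁ t₂, ∀ r ∈ Icc r₁ r₂, ∀ θ ∈ Icc 0 π, boxPoint φ₀ t r θ ∈ W₀) :
    (Continuous fun p : ℝ × ℝ ↦ ∫ r in r₁..r₂,
        H (boxPoint φ₀ (max t₁ (min p.1 t₂)) (max r₁ (min r r₂)) (max 0 (min p.2 π)))) ∧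
      Continuous fun t ↦ ∫ θ in (0 : ℝ)..π, ∫ r in r₁..r₂,
        H (boxPoint φ₀ (max t₁ (min t t₂)) (max r₁ (min r r₂)) (max 0 (min θ π))) := by
  have cH := continuous_clampedComp hH ht hr hbox (φ₀ := φ₀)
  have hin : Continuous fun p : ℝ × ℝ ↦ ∫ r in r₁..r₂,
      H (boxPoint φ₀ (max t₁ (min p.1 t₂)) (max r₁ (min r r₂)) (max 0 (min p.2 π))) := by
    have m : Continuous fun q : (ℝ × ℝ) × ℝ ↦ ((q.1.1, q.2, q.1.2) : ℝ × ℝ × ℝ) :=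
      Continuous.prodMk (continuous_fst.comp continuous_fst) (Continuous.prodMk continuous_snd
        (continuous_snd.comp continuous_fst))
    have h : Continuous (Function.uncurry fun (p : ℝ × ℝ) r ↦
        H (boxPoint φ₀ (max t₁ (min p.1 t₂)) (max r₁ (min r r₂)) (max 0 (min p.2 π)))) := cH.comp m
    exact intervalIntegral.continuous_parametric_intervalIntegral_of_continuous' h r₁ r₂
  refine ⟨hin, ?_⟩
  have h : Continuous (Function.uncurry fun t θ ↦ ∫ r in r₁..r₂,
      H (boxPoint φ₀ (max t₁ (min t t₂)) (max r₁ (min r r₂)) (max 0 (min θ π)))) := hin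
  exact intervalIntegral.continuous_parametric_intervalIntegral_of_continuous' h 0 π

/-- **Integrating a linewise inequality over `(t, θ) ∈ [t₁, t₂] × [0, π]`** (three-level version of
`theta_integral_mono_of_line`). [folklore] -/
theorem t_theta_integral_mono_of_line {F G : E4 → ℝ} (hF : ContinuousOn F W₀) (hG : ContinuousOn G W₀)
    {t₁ t₂ a₁ b₁ a₂ b₂ φ₀ : ℝ} (ht : t₁ ≤ t₂) (h₁ : a₁ ≤ b₁) (h₂ : a₂ ≤ b₂)
    (hbox₁ : ∀ t ∈ Icc t₁ t₂, ∀ r ∈ Icc a₁ b₁, ∀ θ ∈ Icc 0 π, boxPoint φ₀ t r θ ∈ W₀)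
    (hbox₂ : ∀ t ∈ Icc t₁ t₂, ∀ r ∈ Icc a₂ b₂, ∀ θ ∈ Icc 0 π, boxPoint φ₀ t r θ ∈ W₀)
    (hle : ∀ t ∈ Icc t₁ t₂, ∀ θ ∈ Icc 0 π,
      (∫ r in a₁..b₁, F (boxPoint φ₀ t r θ)) ≤ ∫ r in a₂..b₂, G (boxPoint φ₀ t r θ)) :
    (∫ t in t₁..t₂, ∫ θ in (0 : ℝ)..π, ∫ r in a₁..b₁, F (boxPoint φ₀ t r θ)) ≤
      ∫ t in t₁..t₂, ∫ θ in (0 : ℝ)..π, ∫ r in a₂..b₂, G (boxPoint φ₀ t r θ) := by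
  have hπ : (0 : ℝ) ≤ π := pi_pos.le
  obtain ⟨-, cF⟩ := continuous_box_integrals_clamped hF ht h₁ hbox₁ (φ₀ := φ₀)
  obtain ⟨-, cG⟩ := continuous_box_integrals_clamped hG ht h₂ hbox₂ (φ₀ := φ₀)
  have eq3 : ∀ (H : E4 → ℝ) {a b : ℝ}, a ≤ b →
      (∫ t in t₁..t₂, ∫ θ in (0 : ℝ)..π, ∫ r in a..b, H (boxPoint φ₀ t r θ)) =
      ∫ t in t₁..t₂, ∫ θ in (0 : ℝ)..π, ∫ r in a..b,
        H (boxPoint φ₀ (max t₁ (min t t₂)) (max a (min r b)) (max 0 (min θ π))) := by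
    intro H a b hab
    refine intervalIntegral.integral_congr fun t ht' ↦ ?_
    rw [uIcc_of_le ht] at ht'
    refine intervalIntegral.integral_congr fun θ hθ ↦ ?_
    rw [uIcc_of_le hπ] at hθ
    refine intervalIntegral.integral_congr fun r hr' ↦ ?_
    rw [uIcc_of_le hab] at hr'
    simp only [clampI_eq hr', clampI_eq hθ, clampI_eq ht']
  rw [eq3 F h₁, eq3 G h₂]
  refine intervalIntegral.integral_mono_on ht (cF.intervalIntegrable _ _) (cG.intervalIntegrable _ _)
    fun t ht' ↦ ?_
  have e1 : (∫ θ in (0 : ℝ)..π, ∫ r in a₁..b₁,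
      F (boxPoint φ₀ (max t₁ (min t t₂)) (max a₁ (min r b₁)) (max 0 (min θ π)))) =
      ∫ θ in (0 : ℝ)..π, ∫ r in a₁..b₁, F (boxPoint φ₀ t r θ) := by
    refine intervalIntegral.integral_congr fun θ hθ ↦ ?_
    rw [uIcc_of_le hπ] at hθ
    refine intervalIntegral.integral_congr fun r hr' ↦ ?_
    rw [uIcc_of_le h₁] at hr'
    simp only [clampI_eq hr', clampI_eq hθ, clampI_eq ht']
  have e2 : (∫ θ in (0 : ℝ)..π, ∫ r in a₂..b₂,
      G (boxPoint φ₀ (max t₁ (min t t₂)) (max a₂ (min r b₂)) (max 0 (min θ π)))) =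
      ∫ θ in (0 : ℝ)..π, ∫ r in a₂..b₂, G (boxPoint φ₀ t r θ) := by
    refine intervalIntegral.integral_congr fun θ hθ ↦ ?_
    rw [uIcc_of_le hπ] at hθ
    refine intervalIntegral.integral_congr fun r hr' ↦ ?_
    rw [uIcc_of_le h₂] at hr'
    simp only [clampI_eq hr', clampI_eq hθ, clampI_eq ht']
  rw [e1, e2]
  exact theta_integral_mono_of_line hF hG h₁ h₂ (hbox₁ t ht') (hbox₂ t ht') (hle t ht')

/-- The clamped `(t, θ)`-flux integral `r ↦ ∫∫ H(p(t, clamp r, θ))` is continuous, and equals the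
flux integral for `r` in the interval. [folklore] -/
theorem continuous_flux_clamped {H : E4 → ℝ} (hH : ContinuousOn H W₀)
    {t₁ t₂ r₁ r₂ φ₀ : ℝ} (ht : t₁ ≤ t₂) (hr : r₁ ≤ r₂)
    (hbox : ∀ t ∈ Icc t₁ t₂, ∀ r ∈ Icc r₁ r₂, ∀ θ ∈ Icc 0 π, boxPoint φ₀ t r θ ∈ W₀) :
    (Continuous fun p : ℝ × ℝ ↦ ∫ θ in (0 : ℝ)..π,
        H (boxPoint φ₀ (max t₁ (min p.2 t₂)) (max r₁ (min p.1 r₂)) (max 0 (min θ π)))) ∧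
    (Continuous fun r ↦ ∫ t in t₁..t₂, ∫ θ in (0 : ℝ)..π,
        H (boxPoint φ₀ (max t₁ (min t t₂)) (max r₁ (min r r₂)) (max 0 (min θ π)))) ∧
    ∀ r ∈ Icc r₁ r₂, (∫ t in t₁..t₂, ∫ θ in (0 : ℝ)..π,
        H (boxPoint φ₀ (max t₁ (min t t₂)) (max r₁ (min r r₂)) (max 0 (min θ π)))) =
      ∫ t in t₁..t₂, ∫ θ in (0 : ℝ)..π, H (boxPoint φ₀ t r θ) := by
  have hπ : (0 : ℝ) ≤ π := pi_pos.le
  have cH := continuous_clampedComp hH ht hr hbox (φ₀ := φ₀)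
  -- `(r, t) ↦ ∫θ`
  have hin : Continuous fun p : ℝ × ℝ ↦ ∫ θ in (0 : ℝ)..π,
      H (boxPoint φ₀ (max t₁ (min p.2 t₂)) (max r₁ (min p.1 r₂)) (max 0 (min θ π))) := by
    have m : Continuous fun q : (ℝ × ℝ) × ℝ ↦ ((q.1.2, q.1.1, q.2) : ℝ × ℝ × ℝ) :=
      Continuous.prodMk (continuous_snd.comp continuous_fst) (Continuous.prodMk
        (continuous_fst.comp continuous_fst) continuous_snd)
    have h : Continuous (Function.uncurry fun (p : ℝ × ℝ) θ ↦
        H (boxPoint φ₀ (max t₁ (min p.2 t₂)) (max r₁ (min p.1 r₂)) (max 0 (min θ π)))) := cH.comp m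
    exact intervalIntegral.continuous_parametric_intervalIntegral_of_continuous' h 0 π
  refine ⟨hin, ?_, ?_⟩
  · have h : Continuous (Function.uncurry fun r t ↦ ∫ θ in (0 : ℝ)..π,
        H (boxPoint φ₀ (max t₁ (min t t₂)) (max r₁ (min r r₂)) (max 0 (min θ π)))) := hin
    exact intervalIntegral.continuous_parametric_intervalIntegral_of_continuous' h t₁ t₂
  · intro r hr'
    refine intervalIntegral.integral_congr fun t ht' ↦ ?_
    rw [uIcc_of_le ht] at ht'
    refine intervalIntegral.integral_congr fun θ hθ ↦ ?_
    rw [uIcc_of_le hπ] at hθ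
    simp only [clampI_eq hr', clampI_eq hθ, clampI_eq ht']

/-- **Monotonicity of the `(t, θ)`-flux integral at a fixed radius.** [folklore] -/
theorem flux2_integral_mono {F G : E4 → ℝ} (hF : ContinuousOn F W₀) (hG : ContinuousOn G W₀)
    {t₁ t₂ r φ₀ : ℝ} (ht : t₁ ≤ t₂)
    (hbox : ∀ t ∈ Icc t₁ t₂, ∀ θ ∈ Icc 0 π, boxPoint φ₀ t r θ ∈ W₀)
    (hle : ∀ t ∈ Icc t₁ t₂, ∀ θ ∈ Icc 0 π, F (boxPoint φ₀ t r θ) ≤ G (boxPoint φ₀ t r θ)) :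
    (∫ t in t₁..t₂, ∫ θ in (0 : ℝ)..π, F (boxPoint φ₀ t r θ)) ≤
      ∫ t in t₁..t₂, ∫ θ in (0 : ℝ)..π, G (boxPoint φ₀ t r θ) := by
  have hπ : (0 : ℝ) ≤ π := pi_pos.le
  have hbox' : ∀ t ∈ Icc t₁ t₂, ∀ ρ ∈ Icc r r, ∀ θ ∈ Icc 0 π, boxPoint φ₀ t ρ θ ∈ W₀ := by
    intro t ht' ρ hρ θ hθ
    have : ρ = r := le_antisymm hρ.2 hρ.1
    rw [this]; exact hbox t ht' θ hθ
  obtain ⟨cF2, cF1, eF⟩ := continuous_flux_clamped hF ht le_rfl hbox' (φ₀ := φ₀)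
  obtain ⟨cG2, cG1, eG⟩ := continuous_flux_clamped hG ht le_rfl hbox' (φ₀ := φ₀)
  have hrr : r ∈ Icc r r := ⟨le_rfl, le_rfl⟩
  rw [← eF r hrr, ← eG r hrr]
  simp only [clampI_eq hrr]
  have cF := continuous_clampedComp hF ht le_rfl hbox' (φ₀ := φ₀)
  have cG := continuous_clampedComp hG ht le_rfl hbox' (φ₀ := φ₀)
  have hcl : ∀ s : ℝ, max r (min s r) = r := fun s ↦ max_eq_left (min_le_right _ _)
  simp only [hcl] at cF cG cF2 cG2
  have mt : ∀ t : ℝ, Continuous fun θ : ℝ ↦ ((t, r, θ) : ℝ × ℝ × ℝ) := fun t ↦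
    Continuous.prodMk continuous_const (Continuous.prodMk continuous_const continuous_id)
  have mr : Continuous fun t : ℝ ↦ ((r, t) : ℝ × ℝ) := Continuous.prodMk continuous_const continuous_id
  refine intervalIntegral.integral_mono_on ht ((cF2.comp mr).intervalIntegrable _ _)
    ((cG2.comp mr).intervalIntegrable _ _) fun t ht' ↦ ?_
  refine intervalIntegral.integral_mono_on hπ ((cF.comp (mt t)).intervalIntegrable _ _)
    ((cG.comp (mt t)).intervalIntegrable _ _) fun θ hθ ↦ ?_
  simp only [clampI_eq hθ, clampI_eq ht']
  exact hle t ht' θ hθ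

end Plumbing


/-! ### The outer flux of `J^{N,−1/2}` through `{r = 23M/21}` -/

section OuterFlux

variable {W₀ : Set E4} {G : E4 → ℝ}

/-- **The flux of `J^{N,−1/2}` through the outer cylinder of `𝓐_N` is controlled by the transition
slab `{23M/21 ≤ r ≤ 8M/7}`** (the region where the source cuts `N` off, §13.1): for `G` smooth on
an open `W₀ ⊇ [t₁, t₂] × [23M/21, 8M/7] × [0, π]` with `𝓡G + 𝓐G = 0` off the axis,
`∫_{t₁}^{t₂}∫₀^π F_N(t, 23M/21, θ) ≤ 120 (S(t₁) + S(t₂)) + (2620/M) ∫_{t₁}^{t₂} S(t) dt`,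
`S(t) = ∫₀^π∫_{23M/21}^{8M/7} slabDensity` — the energy identity on `[t₁, t₂] × [23M/21, r']` for the
radius `r' ∈ [23M/21, 8M/7]` minimising the outgoing flux (so that it is at most its average, a
slab integral), with the slab energies and bulk bounded by `abs_multDensity_nCurrent_le`,
`mul_abs_multBulk_nCurrent_le`, `abs_multFluxR_nCurrent_le`. [cite: Aretakis2012, §13.1] -/
theorem outerFlux_nCurrent_le (hM : 0 < M) (hW₀ : IsOpen W₀) (hG : ContDiffOn ℝ ∞ G W₀)
    (hP : ∀ q ∈ W₀, sin (q 2) ≠ 0 → radOp M M G q + angOp M G q = 0)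
    {t₁ t₂ φ₀ : ℝ} (ht : t₁ ≤ t₂)
    (hbox : ∀ t ∈ Icc t₁ t₂, ∀ r ∈ Icc (23 / 21 * M) (8 / 7 * M), ∀ θ ∈ Icc 0 π, boxPoint φ₀ t r θ ∈ W₀) :
    (∫ t in t₁..t₂, ∫ θ in (0 : ℝ)..π,
        multFluxR M M (nProfileR M) (nProfileT M) nProfileW G (boxPoint φ₀ t (23 / 21 * M) θ)) ≤
      120 * (∫ θ in (0 : ℝ)..π, ∫ r in (23 / 21 * M)..(8 / 7 * M), slabDensity M G (boxPoint φ₀ t₁ r θ)) +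
      120 * (∫ θ in (0 : ℝ)..π, ∫ r in (23 / 21 * M)..(8 / 7 * M), slabDensity M G (boxPoint φ₀ t₂ r θ)) +
      2620 / M * ∫ t in t₁..t₂, ∫ θ in (0 : ℝ)..π, ∫ r in (23 / 21 * M)..(8 / 7 * M),
        slabDensity M G (boxPoint φ₀ t r θ) := by
  have hπ : (0 : ℝ) ≤ π := pi_pos.le
  have hNR : 23 / 21 * M ≤ 8 / 7 * M := by linarith
  have hNR' : 0 < 8 / 7 * M - 23 / 21 * M := by linarith
  have ht₁ : t₁ ∈ Icc t₁ t₂ := left_mem_Icc.mpr ht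
  have ht₂ : t₂ ∈ Icc t₁ t₂ := right_mem_Icc.mpr ht
  -- abbreviations for the densities (as functions on `E4`)
  obtain ⟨cD, cFl, -, cB⟩ := contDiffOn_mult (M := M) (a := M) hW₀ hG (contDiff_nProfileR M)
    (contDiff_nProfileT M) contDiff_nProfileW
  have h0 := contDiffOn_pd hW₀ hG 0
  have h1 := contDiffOn_pd hW₀ hG 1
  have h2 := contDiffOn_pd hW₀ hG 2
  have hsin : ContDiffOn ℝ ∞ (fun q : E4 ↦ sin (q 2)) W₀ := contDiff_sin.comp_contDiffOn (contDiff_coord 2).contDiffOn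
  have sSD : ContDiffOn ℝ ∞ (slabDensity M G) W₀ := by
    unfold slabDensity
    exact hsin.mul (((contDiffOn_const.mul (hG.pow 2)).add (contDiffOn_const.mul ((h0.pow 2).add
      (h1.pow 2)))).add (contDiffOn_const.mul (h2.pow 2)))
  have cSD : ContinuousOn (slabDensity M G) W₀ := sSD.continuousOn
  -- slab points satisfy `M ≤ r ≤ 2M`
  have hslab : ∀ r ∈ Icc (23 / 21 * M) (8 / 7 * M), M ≤ r ∧ r ≤ 2 * M := fun r hr ↦
    ⟨by linarith [hr.1], by linarith [hr.2]⟩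
  -- (1) the radius minimising the clamped flux
  obtain ⟨cFl2, cFl1, eFl⟩ := continuous_flux_clamped cFl.continuousOn ht hNR hbox (φ₀ := φ₀)
  obtain ⟨r', hr', hmin⟩ := isCompact_Icc.exists_isMinOn (nonempty_Icc.mpr hNR) cFl1.continuousOn
  have hboxr' : ∀ t ∈ Icc t₁ t₂, ∀ r ∈ Icc (23 / 21 * M) r', ∀ θ ∈ Icc 0 π, boxPoint φ₀ t r θ ∈ W₀ :=
    fun t ht' r hr θ hθ ↦ hbox t ht' r ⟨hr.1, hr.2.trans hr'.2⟩ θ hθ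
  -- (2) the identity on `[t₁, t₂] × [23M/21, r']`
  have hid := mult_box_identity (M := M) (a := M) hW₀ hG hP (contDiff_nProfileR M) (contDiff_nProfileT M)
    contDiff_nProfileW ht hr'.1 hboxr'
  rw [flux2_integral_sub cFl.continuousOn ht hr'.1 hboxr'] at hid
  -- (3) the slab energies
  have hD2 : (∫ θ in (0 : ℝ)..π, ∫ r in (23 / 21 * M)..r',
      multDensity M M (nProfileR M) (nProfileT M) nProfileW G (boxPoint φ₀ t₂ r θ)) ≤
      120 * ∫ θ in (0 : ℝ)..π, ∫ r in (23 / 21 * M)..(8 / 7 * M), slabDensity M G (boxPoint φ₀ t₂ r θ) := by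
    have s1 := box2_integral_mono (F := multDensity M M (nProfileR M) (nProfileT M) nProfileW G)
      (G := fun q ↦ 120 * slabDensity M G q) cD.continuousOn (contDiffOn_const.mul sSD).continuousOn hr'.1
      (fun r hr θ hθ ↦ hboxr' t₂ ht₂ r hr θ hθ) (fun r hr θ hθ ↦ (le_abs_self _).trans
        (abs_multDensity_nCurrent_le hM G (q := boxPoint φ₀ t₂ r θ) (by simpa using (hslab r ⟨hr.1, hr.2.trans hr'.2⟩).1)
          (by simpa using (hslab r ⟨hr.1, hr.2.trans hr'.2⟩).2) (by simpa using hθ)))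
    have s2 : (∫ θ in (0 : ℝ)..π, ∫ r in (23 / 21 * M)..r', 120 * slabDensity M G (boxPoint φ₀ t₂ r θ)) ≤
        ∫ θ in (0 : ℝ)..π, ∫ r in (23 / 21 * M)..(8 / 7 * M), 120 * slabDensity M G (boxPoint φ₀ t₂ r θ) := by
      refine theta_integral_mono_of_line (F := fun q ↦ 120 * slabDensity M G q) (G := fun q ↦ 120 * slabDensity M G q)
        (contDiffOn_const.mul sSD).continuousOn (contDiffOn_const.mul sSD).continuousOn hr'.1 hNR
        (fun r hr θ hθ ↦ hboxr' t₂ ht₂ r hr θ hθ) (fun r hr θ hθ ↦ hbox t₂ ht₂ r hr θ hθ) fun θ hθ ↦ ?_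
      have hl : Continuous fun r : ℝ ↦ boxPoint φ₀ t₂ r θ :=
        (continuous_boxPoint φ₀).comp (Continuous.prodMk continuous_const
          (Continuous.prodMk continuous_id continuous_const))
      have hco : ContinuousOn (fun r ↦ 120 * slabDensity M G (boxPoint φ₀ t₂ r θ)) (Icc (23 / 21 * M) (8 / 7 * M)) :=
        (contDiffOn_const.mul sSD).continuousOn.comp hl.continuousOn fun r hr ↦ hbox t₂ ht₂ r hr θ hθ
      refine intervalIntegral.integral_mono_interval le_rfl hr'.1 hr'.2 ?_ (hco.intervalIntegrable_of_Icc hNR)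
      exact MeasureTheory.ae_of_all _ fun r ↦ mul_nonneg (by norm_num)
        (slabDensity_nonneg hM.le G (q := boxPoint φ₀ t₂ r θ) (by simpa using hθ))
    simp only [intervalIntegral.integral_const_mul] at s2
    simp only [intervalIntegral.integral_const_mul] at s1
    linarith
  have hD1 : -(∫ θ in (0 : ℝ)..π, ∫ r in (23 / 21 * M)..r',
      multDensity M M (nProfileR M) (nProfileT M) nProfileW G (boxPoint φ₀ t₁ r θ)) ≤
      120 * ∫ θ in (0 : ℝ)..π, ∫ r in (23 / 21 * M)..(8 / 7 * M), slabDensity M G (boxPoint φ₀ t₁ r θ) := by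
    have s1 := box2_integral_mono (F := fun q ↦ -multDensity M M (nProfileR M) (nProfileT M) nProfileW G q)
      (G := fun q ↦ 120 * slabDensity M G q) cD.continuousOn.neg (contDiffOn_const.mul sSD).continuousOn hr'.1
      (fun r hr θ hθ ↦ hboxr' t₁ ht₁ r hr θ hθ) (fun r hr θ hθ ↦ (neg_le_abs _).trans
        (abs_multDensity_nCurrent_le hM G (q := boxPoint φ₀ t₁ r θ) (by simpa using (hslab r ⟨hr.1, hr.2.trans hr'.2⟩).1)
          (by simpa using (hslab r ⟨hr.1, hr.2.trans hr'.2⟩).2) (by simpa using hθ)))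
    have s2 : (∫ θ in (0 : ℝ)..π, ∫ r in (23 / 21 * M)..r', 120 * slabDensity M G (boxPoint φ₀ t₁ r θ)) ≤
        ∫ θ in (0 : ℝ)..π, ∫ r in (23 / 21 * M)..(8 / 7 * M), 120 * slabDensity M G (boxPoint φ₀ t₁ r θ) := by
      refine theta_integral_mono_of_line (F := fun q ↦ 120 * slabDensity M G q) (G := fun q ↦ 120 * slabDensity M G q)
        (contDiffOn_const.mul sSD).continuousOn (contDiffOn_const.mul sSD).continuousOn hr'.1 hNR
        (fun r hr θ hθ ↦ hboxr' t₁ ht₁ r hr θ hθ) (fun r hr θ hθ ↦ hbox t₁ ht₁ r hr θ hθ) fun θ hθ ↦ ?_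
      have hl : Continuous fun r : ℝ ↦ boxPoint φ₀ t₁ r θ :=
        (continuous_boxPoint φ₀).comp (Continuous.prodMk continuous_const
          (Continuous.prodMk continuous_id continuous_const))
      have hco : ContinuousOn (fun r ↦ 120 * slabDensity M G (boxPoint φ₀ t₁ r θ)) (Icc (23 / 21 * M) (8 / 7 * M)) :=
        (contDiffOn_const.mul sSD).continuousOn.comp hl.continuousOn fun r hr ↦ hbox t₁ ht₁ r hr θ hθ
      refine intervalIntegral.integral_mono_interval le_rfl hr'.1 hr'.2 ?_ (hco.intervalIntegrable_of_Icc hNR)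
      exact MeasureTheory.ae_of_all _ fun r ↦ mul_nonneg (by norm_num)
        (slabDensity_nonneg hM.le G (q := boxPoint φ₀ t₁ r θ) (by simpa using hθ))
    simp only [intervalIntegral.integral_const_mul] at s2
    simp only [intervalIntegral.integral_neg, intervalIntegral.integral_const_mul] at s1
    linarith
  -- (4) the slab bulk
  have hB : (∫ t in t₁..t₂, ∫ θ in (0 : ℝ)..π, ∫ r in (23 / 21 * M)..r',
      multBulk M M (nProfileR M) (nProfileT M) nProfileW G (boxPoint φ₀ t r θ)) ≤
      100 / M * ∫ t in t₁..t₂, ∫ θ in (0 : ℝ)..π, ∫ r in (23 / 21 * M)..(8 / 7 * M),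
        slabDensity M G (boxPoint φ₀ t r θ) := by
    have hpt : ∀ q : E4, M ≤ q 1 → q 1 ≤ 2 * M → q 2 ∈ Icc 0 π →
        multBulk M M (nProfileR M) (nProfileT M) nProfileW G q ≤ 100 / M * slabDensity M G q := by
      intro q h1q h2q hθq
      have h := mul_abs_multBulk_nCurrent_le hM G h1q h2q hθq
      rw [div_mul_eq_mul_div, le_div_iff₀ hM]
      nlinarith [le_abs_self (multBulk M M (nProfileR M) (nProfileT M) nProfileW G q)]
    have s1 := box3_integral_mono (F := multBulk M M (nProfileR M) (nProfileT M) nProfileW G)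
      (G := fun q ↦ 100 / M * slabDensity M G q) cB (contDiffOn_const.mul sSD).continuousOn ht hr'.1 hboxr'
      (fun t ht' r hr θ hθ ↦ hpt (boxPoint φ₀ t r θ) (by simpa using (hslab r ⟨hr.1, hr.2.trans hr'.2⟩).1)
        (by simpa using (hslab r ⟨hr.1, hr.2.trans hr'.2⟩).2) (by simpa using hθ))
    have s2 : (∫ t in t₁..t₂, ∫ θ in (0 : ℝ)..π, ∫ r in (23 / 21 * M)..r',
        100 / M * slabDensity M G (boxPoint φ₀ t r θ)) ≤
        ∫ t in t₁..t₂, ∫ θ in (0 : ℝ)..π, ∫ r in (23 / 21 * M)..(8 / 7 * M),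
          100 / M * slabDensity M G (boxPoint φ₀ t r θ) := by
      refine t_theta_integral_mono_of_line (F := fun q ↦ 100 / M * slabDensity M G q)
        (G := fun q ↦ 100 / M * slabDensity M G q)
        (contDiffOn_const.mul sSD).continuousOn (contDiffOn_const.mul sSD).continuousOn ht hr'.1 hNR hboxr' hbox
        fun t ht' θ hθ ↦ ?_
      have hl : Continuous fun r : ℝ ↦ boxPoint φ₀ t r θ :=
        (continuous_boxPoint φ₀).comp (Continuous.prodMk continuous_const
          (Continuous.prodMk continuous_id continuous_const))
      have hco : ContinuousOn (fun r ↦ 100 / M * slabDensity M G (boxPoint φ₀ t r θ)) (Icc (23 / 21 * M) (8 / 7 * M)) :=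
        (contDiffOn_const.mul sSD).continuousOn.comp hl.continuousOn fun r hr ↦ hbox t ht' r hr θ hθ
      refine intervalIntegral.integral_mono_interval le_rfl hr'.1 hr'.2 ?_ (hco.intervalIntegrable_of_Icc hNR)
      exact MeasureTheory.ae_of_all _ fun r ↦ mul_nonneg (by positivity)
        (slabDensity_nonneg hM.le G (q := boxPoint φ₀ t r θ) (by simpa using hθ))
    simp only [intervalIntegral.integral_const_mul] at s2
    simp only [intervalIntegral.integral_const_mul] at s1
    linarith
  -- (5) the minimal outgoing flux is at most the average, a slab integral
  obtain ⟨cS2, cS1, eS⟩ := continuous_flux_clamped cSD ht hNR hbox (φ₀ := φ₀)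
  have cH := continuous_clampedComp cSD ht hNR hbox (φ₀ := φ₀)
  have hFl : (∫ t in t₁..t₂, ∫ θ in (0 : ℝ)..π,
      multFluxR M M (nProfileR M) (nProfileT M) nProfileW G (boxPoint φ₀ t r' θ)) ≤
      2520 / M * ∫ t in t₁..t₂, ∫ θ in (0 : ℝ)..π, ∫ r in (23 / 21 * M)..(8 / 7 * M),
        slabDensity M G (boxPoint φ₀ t r θ) := by
    -- the clamped flux and the clamped slab flux as functions of the radius
    obtain ⟨Fl, hFldef⟩ : ∃ Fl : ℝ → ℝ, Fl = fun r ↦ ∫ t in t₁..t₂, ∫ θ in (0 : ℝ)..π,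
      multFluxR M M (nProfileR M) (nProfileT M) nProfileW G
        (boxPoint φ₀ (max t₁ (min t t₂)) (max (23 / 21 * M) (min r (8 / 7 * M))) (max 0 (min θ π))) := ⟨_, rfl⟩
    obtain ⟨Sf, hSfdef⟩ : ∃ Sf : ℝ → ℝ, Sf = fun r ↦ ∫ t in t₁..t₂, ∫ θ in (0 : ℝ)..π,
      slabDensity M G (boxPoint φ₀ (max t₁ (min t t₂)) (max (23 / 21 * M) (min r (8 / 7 * M))) (max 0 (min θ π))) :=
      ⟨_, rfl⟩
    rw [← hFldef] at cFl1 hmin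
    rw [← hSfdef] at cS1
    have eFl' : ∀ r ∈ Icc (23 / 21 * M) (8 / 7 * M), Fl r = ∫ t in t₁..t₂, ∫ θ in (0 : ℝ)..π,
        multFluxR M M (nProfileR M) (nProfileT M) nProfileW G (boxPoint φ₀ t r θ) := fun r hr ↦ by
      rw [hFldef]; exact eFl r hr
    have eS' : ∀ r ∈ Icc (23 / 21 * M) (8 / 7 * M), Sf r = ∫ t in t₁..t₂, ∫ θ in (0 : ℝ)..π,
        slabDensity M G (boxPoint φ₀ t r θ) := fun r hr ↦ by
      rw [hSfdef]; exact eS r hr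
    -- (a) minimum ≤ average
    have havg : (8 / 7 * M - 23 / 21 * M) * Fl r' ≤ ∫ r in (23 / 21 * M)..(8 / 7 * M), Fl r := by
      have hc : (∫ r in (23 / 21 * M)..(8 / 7 * M), Fl r') = (8 / 7 * M - 23 / 21 * M) * Fl r' := by
        rw [intervalIntegral.integral_const, smul_eq_mul]
      rw [← hc]
      exact intervalIntegral.integral_mono_on hNR intervalIntegrable_const (cFl1.intervalIntegrable _ _)
        fun r hr ↦ hmin hr
    -- (b) flux ≤ 120 · slab flux, radius by radius
    have hle : ∫ r in (23 / 21 * M)..(8 / 7 * M), Fl r ≤ ∫ r in (23 / 21 * M)..(8 / 7 * M), 120 * Sf r := by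
      refine intervalIntegral.integral_mono_on hNR (cFl1.intervalIntegrable _ _)
        ((continuous_const.mul cS1).intervalIntegrable _ _) fun r hr ↦ ?_
      rw [eFl' r hr, eS' r hr, ← intervalIntegral.integral_const_mul]
      simp_rw [← intervalIntegral.integral_const_mul]
      refine flux2_integral_mono (F := multFluxR M M (nProfileR M) (nProfileT M) nProfileW G)
        (G := fun q ↦ 120 * slabDensity M G q) cFl.continuousOn (contDiffOn_const.mul sSD).continuousOn ht
        (fun t ht' θ hθ ↦ hbox t ht' r hr θ hθ) fun t ht' θ hθ ↦ (le_abs_self _).trans ?_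
      exact abs_multFluxR_nCurrent_le hM G (q := boxPoint φ₀ t r θ) (by simpa using (hslab r hr).1)
        (by simpa using (hslab r hr).2) (by simpa using hθ)
    -- (c) Fubini: `∫ r, Sf r = ∫ t, ∫ θ, ∫ r`
    have hswap : (∫ r in (23 / 21 * M)..(8 / 7 * M), Sf r) =
        ∫ t in t₁..t₂, ∫ θ in (0 : ℝ)..π, ∫ r in (23 / 21 * M)..(8 / 7 * M), slabDensity M G (boxPoint φ₀ t r θ) := by
      rw [hSfdef]
      rw [swap2 (f := fun r t ↦ ∫ θ in (0 : ℝ)..π, slabDensity M G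
        (boxPoint φ₀ (max t₁ (min t t₂)) (max (23 / 21 * M) (min r (8 / 7 * M))) (max 0 (min θ π)))) cS2 hNR ht]
      refine intervalIntegral.integral_congr fun t ht' ↦ ?_
      rw [uIcc_of_le ht] at ht'
      have m : Continuous fun p : ℝ × ℝ ↦ ((t, p.1, p.2) : ℝ × ℝ × ℝ) :=
        Continuous.prodMk continuous_const (Continuous.prodMk continuous_fst continuous_snd)
      have c2 : Continuous (Function.uncurry fun r θ ↦ slabDensity M G
          (boxPoint φ₀ (max t₁ (min t t₂)) (max (23 / 21 * M) (min r (8 / 7 * M))) (max 0 (min θ π)))) := by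
        have h := cH.comp m
        simp only [Function.comp_def] at h
        exact h
      rw [swap2 c2 hNR hπ]
      refine intervalIntegral.integral_congr fun θ hθ ↦ ?_
      rw [uIcc_of_le hπ] at hθ
      refine intervalIntegral.integral_congr fun r hr ↦ ?_
      rw [uIcc_of_le hNR] at hr
      simp only [clampI_eq hr, clampI_eq hθ, clampI_eq ht']
    -- assemble
    have hFl' : Fl r' = ∫ t in t₁..t₂, ∫ θ in (0 : ℝ)..π,
        multFluxR M M (nProfileR M) (nProfileT M) nProfileW G (boxPoint φ₀ t r' θ) := eFl' r' hr'
    rw [← hFl']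
    rw [intervalIntegral.integral_const_mul, hswap] at hle
    have hMpos : 0 < 8 / 7 * M - 23 / 21 * M := hNR'
    rw [div_mul_eq_mul_div, le_div_iff₀ hM]
    have : (8 / 7 * M - 23 / 21 * M) = M / 21 := by ring
    rw [this] at havg
    nlinarith [havg, hle]
  -- (6) conclude
  have hFl' := hFl
  have hsum : 100 / M * (∫ t in t₁..t₂, ∫ θ in (0 : ℝ)..π, ∫ r in (23 / 21 * M)..(8 / 7 * M),
      slabDensity M G (boxPoint φ₀ t r θ)) + 2520 / M * (∫ t in t₁..t₂, ∫ θ in (0 : ℝ)..π,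
      ∫ r in (23 / 21 * M)..(8 / 7 * M), slabDensity M G (boxPoint φ₀ t r θ)) =
      2620 / M * ∫ t in t₁..t₂, ∫ θ in (0 : ℝ)..π, ∫ r in (23 / 21 * M)..(8 / 7 * M),
        slabDensity M G (boxPoint φ₀ t r θ) := by ring
  linarith

end OuterFlux

end StarCoord

end Kerr

end Literature.Geometry.Lorentzian

end
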